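import Literature.Analysis.FluidPDE.BuckmasterVicol
import HarnessLib

/-!
# Barrier: non-uniqueness of finite-energy weak solutions (Buckmaster–Vicol 2019)

Barrier catalogue entry for `NavierStokesRegularity` (D-0021). The result is already vendored as
the named fact `Literature.Analysis.FluidPDE.buckmasterVicol_nonuniqueness`
(`Literature/Analysis/FluidPDE/BuckmasterVicol.lean`, on `𝕋³ = UnitAddTorus (Fin 3)`); this file
records it under `Literature/Barriers/NavierStokesRegularity/` with the structured barrier
docstring that the gate indexes. The main declaration `BuckmasterVicolNonuniqueness` is
*definitionally* the in-tree fact (`buckmasterVicolNonuniqueness_iff`); the proved corollary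
`BuckmasterVicolNonuniqueness.zero_datum_nonunique` extracts the form in which the barrier is
usually quoted ("`v ≡ 0` is not the only weak solution which vanishes at a time slice").

## What is printed (T. Buckmaster, V. Vicol, Ann. of Math. 189 (2019), 101–144 = arXiv:1709.10033)

* Def. 1.1: `v ∈ C⁰(ℝ; L²(𝕋³))` is a *weak solution* if each `v(·,t)` is weakly divergence
  free, has zero mean, and the momentum equation holds in `𝒟'(𝕋³ × ℝ)` against
  divergence-free test fields.
* Thm. 1.2 (Nonuniqueness of weak solutions): there exists `β > 0` such that for any
  nonnegative smooth `e : [0,T] → ℝ_{≥0}` there exists a weak solution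
  `v ∈ C⁰_t([0,T]; H^β_x(𝕋³))` with `∫_{𝕋³} |v(x,t)|² dx = e(t)` for all `t ∈ [0,T]`.
  "In particular, the above theorem shows that `v ≡ 0` is not the only weak solution which
  vanishes at a time slice, thereby implying the nonuniqueness of weak solutions" (p. 4).
* p. 4: the solutions are not shown to be Leray–Hopf ("they do not obey the energy inequality
  or have `L²_t Ḣ¹_x` integrability"); "`β > 0` cannot be expected to be too large, since at
  `β = 1/2` one has weak–strong uniqueness".
* §1.1: the scaling gap between the kinetic energy (`2/p + 3/q = 3/2`) and the critical
  regularity (`2/p + 3/q = 1`) "leaves open the possibility of nonuniqueness of weak solutions".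

## Formalization status (provefact programme, sibling files)

`BuckmasterVicolNonuniqueness_holds` is NOT in the tree. The printed proof of Thm. 1.2 is
§2.4 (half a page) on top of the iterative Prop. 2.1 (§2.3), whose proof is §§3–6 (intermittent
Beltrami flows, the perturbation and its correctors, the new Reynolds stress, the energy
iterate). The sibling files reduce the barrier to Prop. 2.1 alone, everything else machine-checked:

* `BuckmasterVicolNonuniquenessProofs` — the literal statement of Thm. 1.2 (`ν ∈ (0,1]`) as the
  named fact `BuckmasterVicol2019_thm12`, and the PROVED scaling step
  `BuckmasterVicolNonuniqueness_of_thm12` (time rescaling `u(t,x) = ν v(νt,x)` on the unit torus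
  gives all `ν > 0`; this discharges scope caveat (b) below as far as `ν` is concerned).
* `BuckmasterVicolNonuniquenessLimit` — PROVED analysis of §2.4: `L²/H¹` interpolation of the
  increments, lower semicontinuity of `H^s` norms, a.e. Cauchy limits with Fatou tail bounds, and
  the passage to the limit in the weak formulation from Navier–Stokes–Reynolds triples with
  `‖R̊_q‖_{L¹} → 0`.
* `BuckmasterVicolNonuniquenessIteration` — Prop. 2.1 with (2.2)–(2.7) as the named fact
  `BuckmasterVicol2019_prop21` (the XL core, not formalised), and the PROVED assembly
  `BuckmasterVicol2019_thm12_of_prop21`, `BuckmasterVicolNonuniqueness_of_prop21 :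
  BuckmasterVicol2019_prop21 → BuckmasterVicolNonuniqueness`.

Trust base of this barrier entry: `{BuckmasterVicol2019_prop21}` [cite: BuckmasterVicol2019AnnMath, Prop. 2.1].
The later sharpenings quoted in the block below (Cheskidov–Luo, Buckmaster–Colombo–Vicol) are
separate catalogue entries (`SharpLpLinftyNonuniqueness`, …) and do not print Thm. 1.2: CL Thms.
1.5–1.7 are `L^p_t L^∞_x` statements without a prescribed energy profile
[cite: CheskidovLuo2022, Thms. 1.5, 1.6, 1.7].

## References

* T. Buckmaster, V. Vicol, Ann. of Math. 189 (2019), 101–144. [`BuckmasterVicol2019AnnMath`]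
* T. Buckmaster, M. Colombo, V. Vicol, J. Eur. Math. Soc. 24 (2022). [`BuckmasterColomboVicol2021`]
* A. Cheskidov, X. Luo, Invent. Math. 229 (2022), 987–1054. [`CheskidovLuo2022`]
* D. Albritton, E. Brué, M. Colombo, Ann. of Math. 196 (2022). [`AlbrittonBrueColombo2022AnnMath`]
* P. Constantin, C. Foias, *Navier–Stokes Equations* (1988) (weak–strong uniqueness, as cited by BV p. 4). [`ConstantinFoias1988`]
-/

noncomputable section

open MeasureTheory Set
open scoped ContDiff

namespace Literature.Barriers.NavierStokesRegularity

/-- **Barrier (Buckmaster–Vicol 2019): weak solutions of Navier–Stokes with finite kinetic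
energy are not unique.** There is `β > 0` such that for every viscosity `ν > 0`, every `T > 0`
and every smooth nonnegative energy profile `e` on `[0,T]` there is a weak solution `v` of the
unforced Navier–Stokes equations on `𝕋³ × (0,T)` in the sense of BV Def. 1.1 (distributional,
weakly divergence free, mean zero; accepted `Literature.Analysis.FunctionSpaces.Torus.IsWeakNSSolutionOn` plus the mean-zero
conjunct) with `v ∈ C⁰([0,T]; H^β(𝕋³))` and `∫_{𝕋³} |v(x,t)|² dx = e(t)` for all `t ∈ [0,T]`
(BV state `ν ∈ (0,1]`, `𝕋³ = ℝ³/2πℤ³`; the in-tree rendering uses `UnitAddTorus (Fin 3)` and all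
`ν > 0`, see the docstring of `Literature.Analysis.FluidPDE.buckmasterVicol_nonuniqueness`, of which this declaration
is definitionally a copy). [cite: BuckmasterVicol2019AnnMath, Def. 1.1 and Thm. 1.2]

BARRIER (structured block, D-0021):
technique_class: weak-solutions distributional-solutions finite-energy-class convex-integration uniqueness-from-weak-formulation weak-solution-uniqueness
blocks: in the PERIODIC setting of Clay (B) (`Literature.Analysis.FluidPDE.NavierStokesExistenceSmoothPeriodic`), the strengthening "finite-kinetic-energy weak solutions on `𝕋³` are unique / form a well-posedness class" — the in-tree `Literature.Analysis.FluidPDE.buckmasterVicol_nonunique_weak_solutions` records two distinct weak solutions from the zero datum — and, with it, any closing step asserting uniqueness or regularity of ALL distributional solutions in `C⁰_t L²_x(𝕋³)` (or `C⁰_t H^β_x`, small `β > 0`): "weak solutions of the 3D Navier–Stokes equations are not unique in the class of weak solutions with finite kinetic energy" [cite: BuckmasterVicol2019AnnMath, abstract, Thm. 1.2 and p. 4]; on `𝕋^d` this is sharpened to strong nonuniqueness in `L^p_t L^∞_x`, `p < 2`, against the uniqueness class `2/p + d/q ≤ 1` of `Literature.Analysis.FluidPDE.weak_strong_uniqueness`-type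 (ns.S07) results [cite: CheskidovLuo2022, Thms. 1.3 and 1.6], to weak solutions gluing any two strong solutions [cite: BuckmasterColomboVicol2021, Thm. 1.1], and to hyperdissipation `(-Δ)^α`, `1 ≤ α < 5/4` [cite: BuckmasterColomboVicol2021, Thm. 1.5].
because: convex integration with intermittent Beltrami building blocks produces, for ANY smooth energy profile `e ≥ 0` (in particular one vanishing on `[0,T/2]` and positive later), a weak solution with kinetic energy `e(t)`; hence `v ≡ 0` and a nonzero solution share the zero datum, so the weak formulation plus finite energy does not determine the solution [cite: BuckmasterVicol2019AnnMath, Thm. 1.2, p. 4 and §2].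
evasions_known: work in a class where weak–strong uniqueness holds — the constructed solutions are NOT Leray–Hopf (no energy inequality, no `L²_t Ḣ¹_x`) and "`β > 0` cannot be expected to be too large, since at `β = 1/2` one has weak–strong uniqueness" [cite: BuckmasterVicol2019AnnMath, p. 4] [cite: ConstantinFoias1988, weak–strong uniqueness as cited by BV p. 4]; membership in a Ladyzhenskaya–Prodi–Serrin class `L^p_t L^q_x`, `2/p + d/q ≤ 1`, restores uniqueness and the Leray–Hopf property [cite: CheskidovLuo2022, Thm. 1.3]; whether Leray–Hopf solutions of the unforced problem are unique is open (in-tree `Literature.Analysis.FluidPDE.LerayHopfNonUniqueness`), with a force `f ∈ L¹_t L²_x` they are not [cite: AlbrittonBrueColombo2022AnnMath, Thm. 1.2].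
scope_caveats: (a) every cited result is printed on the torus `𝕋³` (BV, BCV) or `𝕋^d` (CL) only — nothing is printed for `ℝ³`, the setting of the summit `NavierStokesRegularity` = Clay (A) [cite: BuckmasterVicol2019AnnMath, Thm. 1.2] [cite: CheskidovLuo2022, Thm. 1.6]; (b) BV take `ν ∈ (0,1]` and `𝕋³ = ℝ³/2πℤ³`, whereas the aliased in-tree fact asserts one `β` for ALL `ν > 0` on `UnitAddTorus (Fin 3)` [cite: BuckmasterVicol2019AnnMath, p. 3] — the passage from `ν ∈ (0,1]` to all `ν > 0` is the proved `BuckmasterVicolNonuniqueness_of_thm12` of the sibling file `BuckmasterVicolNonuniquenessProofs` (time rescaling on the unit torus), the change of period rests on the proof of Prop. 2.1 being insensitive to it (named fact `BuckmasterVicol2019_prop21` of `BuckmasterVicolNonuniquenessIteration`, stated on the unit torus); (c) the vorticity clause of Thm. 1.2 (`curl v ∈ C⁰_t L¹_x`) is dropped in the tree [cite: BuckmasterVicol2019AnnMath, Thm. 1.2]; (d) the solutions are not shown to be Leray–Hopf, so NOTHING is asserted about uniqueness in the Leray–Hopf / suitable class or about smooth solutions [cite: BuckmasterVicol2019AnnMath,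 p. 4]; (e) it is a non-uniqueness statement, not a blow-up: it does not bear on existence of smooth solutions (Clay (A)/(B) themselves).
status: established -/
def BuckmasterVicolNonuniqueness : Prop :=
  Literature.Analysis.FluidPDE.buckmasterVicol_nonuniqueness

/-- `BuckmasterVicolNonuniqueness` is, by definition, the in-tree named fact
`Literature.Analysis.FluidPDE.buckmasterVicol_nonuniqueness`. [cite: BuckmasterVicol2019AnnMath, Thm. 1.2] -/
theorem buckmasterVicolNonuniqueness_iff :
    BuckmasterVicolNonuniqueness ↔ Literature.Analysis.FluidPDE.buckmasterVicol_nonuniqueness :=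
  Iff.rfl

/-- The form in which the barrier is quoted (Buckmaster–Vicol 2019, p. 4: "`v ≡ 0` is not the
only weak solution which vanishes at a time slice"): for every `ν > 0` and `T > 0` there is a
mean-zero weak solution `v ∈ C⁰([0,T]; H^β(𝕋³))` of the unforced Navier–Stokes equations on
`𝕋³ × (0,T)` whose kinetic energy vanishes at `t = 0` and equals `1` at `t = T` — so `v` and the
zero solution are two weak solutions issuing from zero energy. Proved from the barrier fact by
choosing the smooth profile `e(t) = t / T`. [cite: BuckmasterVicol2019AnnMath, Thm. 1.2 and p. 4] -/
theorem BuckmasterVicolNonuniqueness.zero_datum_nonunique (h : BuckmasterVicolNonuniqueness) :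
    ∃ β : ℝ, 0 < β ∧ ∀ ν : ℝ, 0 < ν → ∀ T : ℝ, 0 < T →
      ∃ v : ℝ → UnitAddTorus (Fin 3) → EuclideanSpace ℝ (Fin 3),
        Literature.Analysis.FunctionSpaces.Torus.IsWeakNSSolutionOn T ν v ∧ (∀ t, Literature.Analysis.FunctionSpaces.Torus.HasZeroMean (v t)) ∧
        Literature.Analysis.FunctionSpaces.Torus.ContinuousInSobolevOn (Icc 0 T) β (fun t => Literature.Analysis.FunctionSpaces.EuclideanSpace.complexify ∘ v t) ∧
        (∫ x, ‖v 0 x‖ ^ 2 = 0) ∧ (∫ x, ‖v T x‖ ^ 2 = 1) := by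
  obtain ⟨β, hβ, hall⟩ := h
  refine ⟨β, hβ, fun ν hν T hT => ?_⟩
  have hsmooth : ContDiffOn ℝ ∞ (fun t : ℝ => t / T) (Icc 0 T) :=
    (contDiff_id.div_const T).contDiffOn
  have hnonneg : ∀ t ∈ Icc (0 : ℝ) T, 0 ≤ t / T := fun t ht => div_nonneg ht.1 hT.le
  obtain ⟨v, hweak, hmean, hcont, henergy⟩ := hall ν hν T hT (fun t => t / T) hsmooth hnonneg
  refine ⟨v, hweak, hmean, hcont, ?_, ?_⟩
  · simpa using henergy 0 ⟨le_rfl, hT.le⟩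
  · simpa [div_self hT.ne'] using henergy T ⟨hT.le, le_rfl⟩

end Literature.Barriers.NavierStokesRegularity
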